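import Summits.NavierStokesRegularity.NavierStokesRegularity.Theses.AxisymmetricExtremality
import Literature.Analysis.FluidPDE.AxisymHouLiVariables
import Literature.Analysis.FluidPDE.TaoEnstrophyLocalisationProofs
import HarnessLib

/-!
# The elliptic identity `Δ(u_r/r) + (2/r)∂ᵣ(u_r/r) = ∂₃(ω_θ/r) + (1/r)∂ᵣ(div u)` for axisymmetric
# fields that are NOT divergence free — crux stmt-NavierStokesRegularity-15453
# (`AxisymmetricExtremality.AxisymmetricKatoGlobal`), line registered, support for stub
# `stub_sereginLogSwirlOrigin` (Seregin 2022, Lemma 2.1, localisation step)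

Support file (`--supports stmt-NavierStokesRegularity-15453`; theorems only, everything proved)
toward the registered stub `stub_sereginLogSwirlOrigin` = the named fact
`Literature.Analysis.FluidPDE.seregin2022_logSwirl_regularAtOrigin` (G. Seregin, J. Math. Fluid
Mech. 24 (2022), Paper 27 = arXiv:2201.00153, §2). Lemma 2.1 there bounds `∇(η³v_r/r)` and
`∇̄²(η³v_r/r)` by `η³Γ`, `(η³Γ),₃` (`Γ = ω_θ/r`) plus `C(v, η)`; its proof localises the
div–curl system to `ζv̄` (`ζ = η³`): "`div (ζv̄) = v̄·∇ζ`, `curl (ζv̄) = ζω_θe_θ + ∇ζ × v̄`"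
(arXiv p. 5) — the localised field is compactly supported but no longer divergence free. The
global (divergence-free) core of the lemma is in the tree
(`eLpNorm_fderiv_radVelQuot_le_eLpNorm_angVortQuot`, sibling file `…CFZBounds`), resting on the
pointwise identity `Δρ + 2q_ρ = ∂₂Γ` of `AxisymHouLiVariables`
(`IsAxisymmetric.laplacian_radVelQuot_add`; `ρ = radVelQuot u = u_r/r`,
`Γ = angVortQuot u = ω_θ/r`, `q_F = radDerivQuot F = (∂ᵣF)/r`), whose proof uses `div u = 0`
exactly once, through `∂₀(div u) = 0` at meridian points.

This file removes the divergence-free hypothesis and keeps the source term: for every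
axisymmetric `u ∈ C⁴(ℝ³; ℝ³)` and every `x ∈ ℝ³`,

  `Δ(radVelQuot u) x + 2 radDerivQuot (radVelQuot u) x
      = ∂₂(angVortQuot u) x + radDerivQuot (div u) x`

(`laplacian_radVelQuot_add_eq`; registered sub-goal), i.e. in cylindrical components
(`u = u_r e_r + u_θ e_θ + u₃e₃`, `div u = ∂ᵣu_r + u_r/r + ∂₃u₃`, `rΓ = ∂₃u_r − ∂ᵣu₃`):
`(∂ᵣ² + (3/r)∂ᵣ + ∂₃²)(u_r/r) = ∂₃Γ + (1/r)∂ᵣ(div u)` — indeed with `u_r = rρ`,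
`(1/r)∂ᵣ(div u) = ∂ᵣ²ρ + (3/r)∂ᵣρ + (1/r)∂ᵣ∂₃u₃` and `∂₃Γ = ∂₃²ρ − (1/r)∂₃∂ᵣu₃`. The proof is
the tree's meridian computation verbatim (`laplacian_radVelQuot_add_eq_of_meridian`, adapted
from `IsAxisymmetric.laplacian_radVelQuot_add_of_meridian`) with `∂₀(div u)(x)` kept
(`fderiv_divergence_components`) and identified with `x₀ · radDerivQuot (div u) x`
(`mul_radDerivQuot_eq_fderiv_zero`, `div u` being an axisymmetric `C³` scalar,
`isAxisymmetricScalar_divergence`), followed by the same passage from meridian points to all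
of `ℝ³` (axisymmetry and continuity of both sides, density of `{x₀ ≠ 0}`). The two integrations
by parts that turn it into Seregin's localised `L²` bounds are in the sibling file
`…Lemma21Local`.

## Mathlib / tree search

Tree inputs: `IsAxisymmetric.laplacian_radVelQuot_add_of_meridian` (model, div-free),
`mul_radVelQuot_of_meridian`, `mul_angVortQuot_of_meridian`, `mul_fderiv_fderiv_one_one`,
`mul_fderiv_single_one_apply_one`, `divergence_eq_sum_three`, `hasDerivAt_along_line`,
`line_single_apply`, `IsAxisymmetricScalar.laplacian`, `fderiv_apply_single_two`
(`AxisymHouLiVariables`); `mul_radDerivQuot_eq_fderiv_zero`, `isAxisymmetricScalar_radDerivQuot`,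
`continuous_radDerivQuot` (`AxisymRadialQuotient`); `IsAxisymmetricScalar.mul_fderiv_fderiv_single_one`,
`eq_of_eq_off_ker`, `eq_comp_meridian` (`AxisymmetricLiftR5`, `CylindricalIntegration`);
`contDiff_divergence` (`TaoEnstrophyLocalisationProofs`); `divergence_conj_linearIsometryEquiv`
(`IsometryInvariance`). `lean search 'laplacian_radVelQuot_add_eq|isAxisymmetricScalar_divergence|fderiv_divergence_components '`:
no matches (2026-08-17).

## References

* G. Seregin, J. Math. Fluid Mech. 24 (2022), Paper No. 27 = arXiv:2201.00153, §2, Lemma 2.1,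
  proof ("derive from (1.1) the non-homogeneous system `div(ζv̄) = v̄·∇ζ`, …", arXiv p. 5).
  [`Seregin2022LocalAxisym`]
* Z. Lei, Q. S. Zhang, Pacific J. Math. 289 (2017) 169–187 = arXiv:1505.02628, Lemma 2.1 (the
  relation between `v^r/r` and `Ω` in the divergence-free case). [`LeiZhang2017`]
-/

noncomputable section

open MeasureTheory Set Filter Topology Function
open scoped ContDiff Laplacian
open Literature.Analysis.FluidPDE

-- `<Problem> = <Summit>` duplicates a namespace component by design (lakefile sets the same option).
set_option linter.dupNamespace false

namespace Summit.NavierStokesRegularity.NavierStokesRegularity.Theorems.AxisymmetricKatoGlobal.EulerScaling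

variable {u : EuclideanSpace ℝ (Fin 3) → EuclideanSpace ℝ (Fin 3)}

/-! ### The divergence of an axisymmetric field -/

/-- **Derivatives of `div u` in components**: `∂ᵥ∂₀u₀ + ∂ᵥ∂₁u₁ + ∂ᵥ∂₂u₂ = ∂ᵥ(div u)` for
`u ∈ C²` (the tree's `fderiv_divergence_components_eq_zero` without `div u = 0`). [folklore] -/
theorem fderiv_divergence_components (hu : ContDiff ℝ 2 u) (x v : EuclideanSpace ℝ (Fin 3)) :
    fderiv ℝ (fun y => fderiv ℝ u y (EuclideanSpace.single 0 1) 0) x v +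
      fderiv ℝ (fun y => fderiv ℝ u y (EuclideanSpace.single 1 1) 1) x v +
      fderiv ℝ (fun y => fderiv ℝ u y (EuclideanSpace.single 2 1) 2) x v =
      fderiv ℝ (VectorCalculus.divergence u) x v := by
  have hdi : ∀ i : Fin 3, Differentiable ℝ fun y => fderiv ℝ u y (EuclideanSpace.single i 1) i :=
    fun i => (contDiff_apply_coord_vec3 (contDiff_fderiv_apply_const_succ (n := 1)
      (by exact_mod_cast hu) _) i).differentiable one_ne_zero
  have hfun : VectorCalculus.divergence u = fun y => fderiv ℝ u y (EuclideanSpace.single 0 1) 0 +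
      fderiv ℝ u y (EuclideanSpace.single 1 1) 1 + fderiv ℝ u y (EuclideanSpace.single 2 1) 2 :=
    funext fun y => divergence_eq_sum_three u y
  rw [hfun, fderiv_fun_add ((hdi 0 x).fun_add (hdi 1 x)) (hdi 2 x), fderiv_fun_add (hdi 0 x) (hdi 1 x)]
  rfl

/-- **The divergence of an axisymmetric field is an axisymmetric scalar** (`div` commutes with
the conjugation `u ↦ R_θ ∘ u ∘ R_θ⁻¹`, which fixes an axisymmetric `u`). [folklore] -/
theorem isAxisymmetricScalar_divergence (hax : IsAxisymmetric u) :
    IsAxisymmetricScalar (VectorCalculus.divergence u) := by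
  intro θ x
  have hfun : (fun y => rotZLIE θ (u ((rotZLIE θ).symm y))) = u := funext fun y => by
    have hy : rotZ θ (rotZ (-θ) y) = y := by simpa using rotZ_neg_apply_rotZ (-θ) y
    rw [rotZLIE_symm_apply, rotZLIE_apply, ← hax θ (rotZ (-θ) y), hy]
  have h := divergence_conj_linearIsometryEquiv (rotZLIE θ) u (rotZ θ x)
  rw [hfun, rotZLIE_symm_apply, rotZ_neg_apply_rotZ] at h
  exact h

/-! ### The identity at meridian points off the axis -/

/-- **The identity at meridian points off the axis, with the divergence kept.** For an
axisymmetric `u ∈ C⁴` (not necessarily divergence free) and `x` with `x₁ = 0`, `x₀ ≠ 0`: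
`Δ(u_r/r)(x) + 2 radDerivQuot (u_r/r)(x) = ∂₂(ω_θ/r)(x) + radDerivQuot (div u)(x)`.
The computation is the tree's (`IsAxisymmetric.laplacian_radVelQuot_add_of_meridian`: restrict
`x₀ · (u_r/r) = u₀` to the lines through `x` along `e₀`, `e₂`; cylindrical Laplacian
`∂₀² + (1/x₀)∂₀ + ∂₂²` of axisymmetric scalars; `x₀ · (ω_θ/r) = ∂₂u₀ − ∂₀u₂`; `∂₁u₁ = u₀/x₀`,
`x₀∂₀∂₁u₁ = ∂₀u₀ − ∂₁u₁` on the meridian plane), the only change being that the difference of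
the two sides, `(1/x₀) ∂₀(∂₀u₀ + ∂₁u₁ + ∂₂u₂) = (1/x₀)∂₀(div u)`, is now `radDerivQuot (div u) x`
instead of `0`. [cite: Seregin2022LocalAxisym, §2 Lemma 2.1, proof (arXiv:2201.00153 p. 5: div(ζv̄) = v̄·∇ζ)] -/
theorem laplacian_radVelQuot_add_eq_of_meridian (hax : IsAxisymmetric u)
    (hu : ContDiff ℝ 4 u) {x : EuclideanSpace ℝ (Fin 3)} (hx1 : x 1 = 0) (hx0 : x 0 ≠ 0) :
    (Δ (radVelQuot u)) x + 2 * radDerivQuot (radVelQuot u) x =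
      fderiv ℝ (angVortQuot u) x (EuclideanSpace.single 2 1) +
        radDerivQuot (VectorCalculus.divergence u) x := by
  -- regularity
  have hu2 : ContDiff ℝ 2 u := hu.of_le (by norm_num)
  have hu3 : ContDiff ℝ 3 u := hu.of_le (by norm_num)
  have hud : Differentiable ℝ u := hu.differentiable (by norm_num)
  have hρ2 : ContDiff ℝ 2 (radVelQuot u) :=
    contDiff_radVelQuot (n := 2) (by exact_mod_cast hu)
  have hρd : Differentiable ℝ (radVelQuot u) := hρ2.differentiable two_ne_zero
  have hρax : IsAxisymmetricScalar (radVelQuot u) := hax.isAxisymmetricScalar_radVelQuot hu2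
  have hω1 : ContDiff ℝ 1 (angVortQuot u) :=
    contDiff_angVortQuot (n := 1) (by exact_mod_cast hu)
  have hωd : Differentiable ℝ (angVortQuot u) := hω1.differentiable one_ne_zero
  have hdρ0 : Differentiable ℝ fun y => fderiv ℝ (radVelQuot u) y (EuclideanSpace.single 0 1) :=
    (contDiff_fderiv_apply_const_succ (n := 1) (by exact_mod_cast hρ2) _).differentiable
      one_ne_zero
  have hdρ2 : Differentiable ℝ fun y => fderiv ℝ (radVelQuot u) y (EuclideanSpace.single 2 1) :=
    (contDiff_fderiv_apply_const_succ (n := 1) (by exact_mod_cast hρ2) _).differentiable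
      one_ne_zero
  have hdu : ∀ (v : EuclideanSpace ℝ (Fin 3)) (i : Fin 3),
      Differentiable ℝ fun y => fderiv ℝ u y v i := fun v i =>
    (contDiff_apply_coord_vec3 (contDiff_fderiv_apply_const_succ (n := 1) (by exact_mod_cast hu2) v)
      i).differentiable one_ne_zero
  have hdu0 : ∀ i : Fin 3, Differentiable ℝ fun y => u y i := fun i =>
    (contDiff_apply_coord_vec3 hu2 i).differentiable two_ne_zero
  -- coordinates on the two lines through `x`
  have l0_0 : ∀ s : ℝ, (x + s • EuclideanSpace.single (0 : Fin 3) (1 : ℝ)) 0 = x 0 + s :=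
    fun s => by rw [line_single_apply]; simp
  have l0_1 : ∀ s : ℝ, (x + s • EuclideanSpace.single (0 : Fin 3) (1 : ℝ)) 1 = 0 :=
    fun s => by rw [line_single_apply, hx1]; simp
  have l2_0 : ∀ s : ℝ, (x + s • EuclideanSpace.single (2 : Fin 3) (1 : ℝ)) 0 = x 0 :=
    fun s => by rw [line_single_apply]; simp
  have l2_1 : ∀ s : ℝ, (x + s • EuclideanSpace.single (2 : Fin 3) (1 : ℝ)) 1 = 0 :=
    fun s => by rw [line_single_apply, hx1]; simp
  /- (1) the line through `x` along `e₀`: `(x₀ + s) ρ = u₀` -/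
  have hgU : (fun s : ℝ => (x 0 + s) * radVelQuot u (x + s • EuclideanSpace.single 0 1)) =
      fun s => u (x + s • EuclideanSpace.single 0 1) 0 := funext fun s => by
    have h := hax.mul_radVelQuot_of_meridian hu2 (l0_1 s)
    rwa [l0_0] at h
  -- first derivatives along the line
  have hg1 : ∀ s : ℝ, HasDerivAt (fun s : ℝ => radVelQuot u (x + s • EuclideanSpace.single 0 1))
      (fderiv ℝ (radVelQuot u) (x + s • EuclideanSpace.single 0 1) (EuclideanSpace.single 0 1)) s :=
    fun s => hasDerivAt_along_line (hρd _)
  have hU1 : ∀ s : ℝ, HasDerivAt (fun s : ℝ => u (x + s • EuclideanSpace.single 0 1) 0)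
      (fderiv ℝ (fun y => u y 0) (x + s • EuclideanSpace.single 0 1) (EuclideanSpace.single 0 1))
      s := fun s => hasDerivAt_along_line (f := fun y => u y 0) (hdu0 0 _)
  have hprod : ∀ s : ℝ, HasDerivAt (fun s : ℝ => u (x + s • EuclideanSpace.single 0 1) 0)
      (1 * radVelQuot u (x + s • EuclideanSpace.single 0 1) + (x 0 + s) *
        fderiv ℝ (radVelQuot u) (x + s • EuclideanSpace.single 0 1) (EuclideanSpace.single 0 1))
      s := fun s => by
    rw [← hgU]
    exact ((hasDerivAt_id s).const_add (x 0)).mul (hg1 s)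
  have hR1fun : (fun s : ℝ => fderiv ℝ (fun y => u y 0) (x + s • EuclideanSpace.single 0 1)
      (EuclideanSpace.single 0 1)) = fun s => 1 * radVelQuot u (x + s • EuclideanSpace.single 0 1) +
      (x 0 + s) * fderiv ℝ (radVelQuot u) (x + s • EuclideanSpace.single 0 1)
        (EuclideanSpace.single 0 1) := funext fun s => (hU1 s).unique (hprod s)
  -- second derivatives along the line
  have hG1 : ∀ s : ℝ, HasDerivAt (fun s : ℝ => fderiv ℝ (radVelQuot u)
      (x + s • EuclideanSpace.single 0 1) (EuclideanSpace.single 0 1))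
      (fderiv ℝ (fun y => fderiv ℝ (radVelQuot u) y (EuclideanSpace.single 0 1))
        (x + s • EuclideanSpace.single 0 1) (EuclideanSpace.single 0 1)) s := fun s =>
    hasDerivAt_along_line (f := fun y => fderiv ℝ (radVelQuot u) y (EuclideanSpace.single 0 1))
      (hdρ0 _)
  have hV1 : ∀ s : ℝ, HasDerivAt (fun s : ℝ => fderiv ℝ (fun y => u y 0)
      (x + s • EuclideanSpace.single 0 1) (EuclideanSpace.single 0 1))
      (fderiv ℝ (fun y => fderiv ℝ (fun y => u y 0) y (EuclideanSpace.single 0 1))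
        (x + s • EuclideanSpace.single 0 1) (EuclideanSpace.single 0 1)) s := fun s => by
    refine hasDerivAt_along_line (f := fun y => fderiv ℝ (fun y => u y 0) y
      (EuclideanSpace.single 0 1)) ?_
    have hfun : (fun y => fderiv ℝ (fun y => u y 0) y (EuclideanSpace.single 0 1)) =
        fun y => fderiv ℝ u y (EuclideanSpace.single 0 1) 0 :=
      funext fun y => fderiv_apply_coord_vec3 (hud y) 0 _
    rw [hfun]
    exact hdu _ 0 _
  have hprod2 : HasDerivAt (fun s : ℝ => fderiv ℝ (fun y => u y 0)
      (x + s • EuclideanSpace.single 0 1) (EuclideanSpace.single 0 1))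
      (1 * fderiv ℝ (radVelQuot u) (x + (0 : ℝ) • EuclideanSpace.single 0 1)
          (EuclideanSpace.single 0 1) +
        (1 * fderiv ℝ (radVelQuot u) (x + (0 : ℝ) • EuclideanSpace.single 0 1)
          (EuclideanSpace.single 0 1) + (x 0 + id (0 : ℝ)) *
          fderiv ℝ (fun y => fderiv ℝ (radVelQuot u) y (EuclideanSpace.single 0 1))
            (x + (0 : ℝ) • EuclideanSpace.single 0 1) (EuclideanSpace.single 0 1))) 0 := by
    rw [hR1fun]
    exact ((hg1 0).const_mul 1).add (((hasDerivAt_id (0 : ℝ)).const_add (x 0)).mul (hG1 0))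
  have hR2 := (hV1 0).unique hprod2
  have hR1 := congrFun hR1fun 0
  simp only [zero_smul, add_zero, one_mul, id_eq] at hR1 hR2
  -- rewrite the `u₀`-derivatives as components of derivatives of `u`
  have hcoord1 : fderiv ℝ (fun y => u y 0) x (EuclideanSpace.single 0 1) =
      fderiv ℝ u x (EuclideanSpace.single 0 1) 0 := fderiv_apply_coord_vec3 (hud x) 0 _
  have hcoord2 : fderiv ℝ (fun y => fderiv ℝ (fun y => u y 0) y (EuclideanSpace.single 0 1)) x
      (EuclideanSpace.single 0 1) =
      fderiv ℝ (fun y => fderiv ℝ u y (EuclideanSpace.single 0 1) 0) x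
        (EuclideanSpace.single 0 1) := by
    have hfun : (fun y => fderiv ℝ (fun y => u y 0) y (EuclideanSpace.single 0 1)) =
        fun y => fderiv ℝ u y (EuclideanSpace.single 0 1) 0 :=
      funext fun y => fderiv_apply_coord_vec3 (hud y) 0 _
    rw [hfun]
  rw [hcoord1] at hR1
  rw [hcoord2] at hR2
  /- (2) the line through `x` along `e₂`: `x₀ ρ = u₀` -/
  have hhW : (fun s : ℝ => x 0 * radVelQuot u (x + s • EuclideanSpace.single 2 1)) =
      fun s => u (x + s • EuclideanSpace.single 2 1) 0 := funext fun s => by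
    have h := hax.mul_radVelQuot_of_meridian hu2 (l2_1 s)
    rwa [l2_0] at h
  have hh1 : ∀ s : ℝ, HasDerivAt (fun s : ℝ => radVelQuot u (x + s • EuclideanSpace.single 2 1))
      (fderiv ℝ (radVelQuot u) (x + s • EuclideanSpace.single 2 1) (EuclideanSpace.single 2 1)) s :=
    fun s => hasDerivAt_along_line (hρd _)
  have hW1 : ∀ s : ℝ, HasDerivAt (fun s : ℝ => u (x + s • EuclideanSpace.single 2 1) 0)
      (fderiv ℝ (fun y => u y 0) (x + s • EuclideanSpace.single 2 1) (EuclideanSpace.single 2 1))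
      s := fun s => hasDerivAt_along_line (f := fun y => u y 0) (hdu0 0 _)
  have hS1fun : (fun s : ℝ => fderiv ℝ (fun y => u y 0) (x + s • EuclideanSpace.single 2 1)
      (EuclideanSpace.single 2 1)) = fun s => x 0 * fderiv ℝ (radVelQuot u)
      (x + s • EuclideanSpace.single 2 1) (EuclideanSpace.single 2 1) := funext fun s => by
    refine (hW1 s).unique ?_
    rw [← hhW]
    exact (hh1 s).const_mul (x 0)
  have hH1 : HasDerivAt (fun s : ℝ => fderiv ℝ (radVelQuot u)
      (x + s • EuclideanSpace.single 2 1) (EuclideanSpace.single 2 1))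
      (fderiv ℝ (fun y => fderiv ℝ (radVelQuot u) y (EuclideanSpace.single 2 1))
        (x + (0 : ℝ) • EuclideanSpace.single 2 1) (EuclideanSpace.single 2 1)) 0 :=
    hasDerivAt_along_line (f := fun y => fderiv ℝ (radVelQuot u) y (EuclideanSpace.single 2 1))
      (hdρ2 _)
  have hX1 : HasDerivAt (fun s : ℝ => fderiv ℝ (fun y => u y 0)
      (x + s • EuclideanSpace.single 2 1) (EuclideanSpace.single 2 1))
      (fderiv ℝ (fun y => fderiv ℝ (fun y => u y 0) y (EuclideanSpace.single 2 1))
        (x + (0 : ℝ) • EuclideanSpace.single 2 1) (EuclideanSpace.single 2 1)) 0 := by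
    refine hasDerivAt_along_line (f := fun y => fderiv ℝ (fun y => u y 0) y
      (EuclideanSpace.single 2 1)) ?_
    have hfun : (fun y => fderiv ℝ (fun y => u y 0) y (EuclideanSpace.single 2 1)) =
        fun y => fderiv ℝ u y (EuclideanSpace.single 2 1) 0 :=
      funext fun y => fderiv_apply_coord_vec3 (hud y) 0 _
    rw [hfun]
    exact hdu _ 0 _
  have hprod3 : HasDerivAt (fun s : ℝ => fderiv ℝ (fun y => u y 0)
      (x + s • EuclideanSpace.single 2 1) (EuclideanSpace.single 2 1))
      (x 0 * fderiv ℝ (fun y => fderiv ℝ (radVelQuot u) y (EuclideanSpace.single 2 1))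
        (x + (0 : ℝ) • EuclideanSpace.single 2 1) (EuclideanSpace.single 2 1)) 0 := by
    rw [hS1fun]
    exact hH1.const_mul (x 0)
  have hR3 := hX1.unique hprod3
  have hcoord3 : fderiv ℝ (fun y => fderiv ℝ (fun y => u y 0) y (EuclideanSpace.single 2 1)) x
      (EuclideanSpace.single 2 1) =
      fderiv ℝ (fun y => fderiv ℝ u y (EuclideanSpace.single 2 1) 0) x
        (EuclideanSpace.single 2 1) := by
    have hfun : (fun y => fderiv ℝ (fun y => u y 0) y (EuclideanSpace.single 2 1)) =
        fun y => fderiv ℝ u y (EuclideanSpace.single 2 1) 0 :=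
      funext fun y => fderiv_apply_coord_vec3 (hud y) 0 _
    rw [hfun]
  simp only [zero_smul, add_zero] at hR3
  rw [hcoord3] at hR3
  /- (3) the line through `x` along `e₂` for `ω^θ/r`: `x₀ ω₁ = ∂₂u₀ − ∂₀u₂` -/
  have hkC : (fun s : ℝ => x 0 * angVortQuot u (x + s • EuclideanSpace.single 2 1)) =
      fun s => fderiv ℝ u (x + s • EuclideanSpace.single 2 1) (EuclideanSpace.single 2 1) 0 -
        fderiv ℝ u (x + s • EuclideanSpace.single 2 1) (EuclideanSpace.single 0 1) 2 :=
    funext fun s => by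
      have h := hax.mul_angVortQuot_of_meridian hu3 (l2_1 s)
      rwa [l2_0, curl_apply_one_eq_sub] at h
  have hk1 : HasDerivAt (fun s : ℝ => x 0 * angVortQuot u (x + s • EuclideanSpace.single 2 1))
      (x 0 * fderiv ℝ (angVortQuot u) (x + (0 : ℝ) • EuclideanSpace.single 2 1)
        (EuclideanSpace.single 2 1)) 0 :=
    (hasDerivAt_along_line (hωd _)).const_mul (x 0)
  have hC1 : HasDerivAt (fun s : ℝ =>
      fderiv ℝ u (x + s • EuclideanSpace.single 2 1) (EuclideanSpace.single 2 1) 0 -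
        fderiv ℝ u (x + s • EuclideanSpace.single 2 1) (EuclideanSpace.single 0 1) 2)
      (fderiv ℝ (fun y => fderiv ℝ u y (EuclideanSpace.single 2 1) 0)
          (x + (0 : ℝ) • EuclideanSpace.single 2 1) (EuclideanSpace.single 2 1) -
        fderiv ℝ (fun y => fderiv ℝ u y (EuclideanSpace.single 0 1) 2)
          (x + (0 : ℝ) • EuclideanSpace.single 2 1) (EuclideanSpace.single 2 1)) 0 :=
    (hasDerivAt_along_line (f := fun y => fderiv ℝ u y (EuclideanSpace.single 2 1) 0)
      (hdu _ 0 _)).sub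
      (hasDerivAt_along_line (f := fun y => fderiv ℝ u y (EuclideanSpace.single 0 1) 2) (hdu _ 2 _))
  rw [hkC] at hk1
  have hR4 := hk1.unique hC1
  simp only [zero_smul, add_zero] at hR4
  /- (4) the remaining pointwise relations at `x` -/
  have hR5 := hρax.mul_fderiv_fderiv_single_one hρ2 hx1
  have hR6 := mul_radDerivQuot_eq_fderiv_zero hρ2 hρax x
  have hLB := hax.mul_fderiv_fderiv_one_one hu2 hx1
  have hLA := hax.mul_fderiv_single_one_apply_one hud hx1
  have hLE := hax.mul_radVelQuot_of_meridian hu2 hx1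
  have hLD := fderiv_divergence_components hu2 x (EuclideanSpace.single 0 1)
  -- `x₀ · q_{div u} = ∂₀ (div u)` (the source term kept: `u` is not divergence free)
  have hQ := mul_radDerivQuot_eq_fderiv_zero (contDiff_divergence (n := 2) (by exact_mod_cast hu3))
    (isAxisymmetricScalar_divergence hax) x
  have hSYM : fderiv ℝ (fun y => fderiv ℝ u y (EuclideanSpace.single 2 1) 2) x
      (EuclideanSpace.single 0 1) =
      fderiv ℝ (fun y => fderiv ℝ u y (EuclideanSpace.single 0 1) 2) x
        (EuclideanSpace.single 2 1) := by
    have hw2 : DifferentiableAt ℝ (fun y => fderiv ℝ u y (EuclideanSpace.single 2 1)) x :=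
      (contDiff_fderiv_apply_const_succ (n := 1) (by exact_mod_cast hu2) _).differentiable
        one_ne_zero x
    have hw0 : DifferentiableAt ℝ (fun y => fderiv ℝ u y (EuclideanSpace.single 0 1)) x :=
      (contDiff_fderiv_apply_const_succ (n := 1) (by exact_mod_cast hu2) _).differentiable
        one_ne_zero x
    rw [fderiv_apply_coord_vec3 hw2, fderiv_apply_coord_vec3 hw0, fderiv_fderiv_apply_comm_vec hu2]
  have hLap : (Δ (radVelQuot u)) x =
      fderiv ℝ (fun y => fderiv ℝ (radVelQuot u) y (EuclideanSpace.single 0 1)) x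
          (EuclideanSpace.single 0 1) +
        fderiv ℝ (fun y => fderiv ℝ (radVelQuot u) y (EuclideanSpace.single 1 1)) x
          (EuclideanSpace.single 1 1) +
        fderiv ℝ (fun y => fderiv ℝ (radVelQuot u) y (EuclideanSpace.single 2 1)) x
          (EuclideanSpace.single 2 1) := by
    rw [laplacian_eq_sum_fderiv_fderiv (EuclideanSpace.basisFun (Fin 3) ℝ) hρ2 x]
    simp only [EuclideanSpace.basisFun_apply, Fin.sum_univ_three]
  -- `∂₁u₁ = ρ` at `x`
  have hd1u1 : fderiv ℝ u x (EuclideanSpace.single 1 1) 1 = radVelQuot u x :=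
    mul_left_cancel₀ hx0 (hLA.trans hLE.symm)
  -- `∂₀∂₁u₁ = ∂₀ρ` at `x`
  have hN : x 0 * fderiv ℝ (fun y => fderiv ℝ u y (EuclideanSpace.single 1 1) 1) x
      (EuclideanSpace.single 0 1) =
      x 0 * fderiv ℝ (radVelQuot u) x (EuclideanSpace.single 0 1) := by
    linear_combination hLB + hR1 - hd1u1
  have hN' := mul_left_cancel₀ hx0 hN
  -- conclude: multiply the goal by `x₀`
  apply mul_left_cancel₀ hx0
  rw [hLap]
  linear_combination -hR2 + hR5 - hR3 + 2 * hR6 - hR4 + hLD - hSYM - hN' - hQ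

/-! ### The identity everywhere -/

/-- **`Δ(u_r/r) + (2/r)∂ᵣ(u_r/r) = ∂₃(ω_θ/r) + (1/r)∂ᵣ(div u)` on all of `ℝ³`** for every
axisymmetric `u ∈ C⁴(ℝ³; ℝ³)`, divergence free or not:
`Δ(radVelQuot u) x + 2 radDerivQuot (radVelQuot u) x = ∂₂(angVortQuot u) x + radDerivQuot (div u) x`.
Both sides are continuous axisymmetric scalars agreeing at meridian points off the axis
(`laplacian_radVelQuot_add_eq_of_meridian`), hence off `{x₀ = 0}` by rotation to the meridian
half-plane, hence everywhere by density. For `div u = 0` this is the tree's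
`IsAxisymmetric.laplacian_radVelQuot_add` (Lei–Zhang 2017, Lemma 2.1); the source
`radDerivQuot (div u)` is what Seregin's localisation `u = ζv̄` (`div u = v̄·∇ζ`) produces.
Registered sub-goal toward `stub_sereginLogSwirlOrigin`. [cite: Seregin2022LocalAxisym, §2 Lemma 2.1, proof (arXiv:2201.00153 p. 5: div(ζv̄) = v̄·∇ζ)] [cite: LeiZhang2017, Lemma 2.1 (the relation between v^r/r and Ω)] -/
theorem laplacian_radVelQuot_add_eq : ∀ u : EuclideanSpace ℝ (Fin 3) → EuclideanSpace ℝ (Fin 3), IsAxisymmetric u → ContDiff ℝ 4 u → ∀ x : EuclideanSpace ℝ (Fin 3), (Δ (radVelQuot u)) x + 2 * radDerivQuot (radVelQuot u) x = fderiv ℝ (angVortQuot u) x (EuclideanSpace.single 2 1) + radDerivQuot (VectorCalculus.divergence u) x := by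
  intro u hax hu x
  have hu2 : ContDiff ℝ 2 u := hu.of_le (by norm_num)
  have hu3 : ContDiff ℝ 3 u := hu.of_le (by norm_num)
  have hρ2 : ContDiff ℝ 2 (radVelQuot u) := contDiff_radVelQuot (n := 2) (by exact_mod_cast hu)
  have hρax : IsAxisymmetricScalar (radVelQuot u) := hax.isAxisymmetricScalar_radVelQuot hu2
  have hω1 : ContDiff ℝ 1 (angVortQuot u) := contDiff_angVortQuot (n := 1) (by exact_mod_cast hu)
  have hωax : IsAxisymmetricScalar (angVortQuot u) := hax.isAxisymmetricScalar_angVortQuot hu3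
  have hD2 : ContDiff ℝ 2 (VectorCalculus.divergence u) :=
    contDiff_divergence (n := 2) (by exact_mod_cast hu3)
  have hDax : IsAxisymmetricScalar (VectorCalculus.divergence u) := isAxisymmetricScalar_divergence hax
  -- the two sides as axisymmetric scalars
  set L : EuclideanSpace ℝ (Fin 3) → ℝ := fun y =>
    (Δ (radVelQuot u)) y + 2 * radDerivQuot (radVelQuot u) y with hL
  set R : EuclideanSpace ℝ (Fin 3) → ℝ := fun y =>
    fderiv ℝ (angVortQuot u) y (EuclideanSpace.single 2 1) +
      radDerivQuot (VectorCalculus.divergence u) y with hR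
  have hLax : IsAxisymmetricScalar L := fun θ y => by
    simp only [hL]
    rw [hρax.laplacian θ y, isAxisymmetricScalar_radDerivQuot hρ2 hρax θ y]
  have hRax : IsAxisymmetricScalar R := fun θ y => by
    have h1 : fderiv ℝ (angVortQuot u) (rotZ θ y) (EuclideanSpace.single 2 1) =
        fderiv ℝ (angVortQuot u) y (EuclideanSpace.single 2 1) :=
      hωax.fderiv_apply_single_two (hω1.differentiable one_ne_zero) θ y
    simp only [hR]
    rw [h1, isAxisymmetricScalar_radDerivQuot hD2 hDax θ y]
  have hLc : Continuous L :=
    (continuous_laplacian hρ2).add (continuous_const.mul (continuous_radDerivQuot hρ2))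
  have hRc : Continuous R :=
    (contDiff_fderiv_apply_const_succ (n := 0) (by exact_mod_cast hω1) _).continuous.add
      (continuous_radDerivQuot hD2)
  show L x = R x
  refine eq_of_eq_off_ker (EuclideanSpace.proj (0 : Fin 3)) ⟨EuclideanSpace.single 0 1, by simp⟩
    hLc hRc (fun z hz => ?_) x
  have hz0 : z 0 ≠ 0 := by simpa using hz
  have hr : cylRadius z ≠ 0 := fun h => hz0 ((cylRadius_eq_zero_iff z).1 h).1
  -- rotate to the meridian half-plane
  rw [hLax.eq_comp_meridian z, hRax.eq_comp_meridian z]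
  have hm1 : meridianPoint (meridian z) 1 = 0 := rfl
  have hm0 : meridianPoint (meridian z) 0 ≠ 0 := by
    rw [meridianPoint_apply_zero, meridian_apply]; exact hr
  exact laplacian_radVelQuot_add_eq_of_meridian hax hu hm1 hm0

end Summit.NavierStokesRegularity.NavierStokesRegularity.Theorems.AxisymmetricKatoGlobal.EulerScaling

end
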